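import Summits.QuantumAdvantage.QuantumAdvantage.Theorems.PurityDialLawC

/-! # PurityDialLawD — part 4/13 (mechanical split for landing of `PurityDialLaw`; content verbatim; scopes re-opened with their variables) -/

set_option linter.dupNamespace false
noncomputable section

namespace Summit.QuantumAdvantage.QuantumAdvantage.Theorems.PurityDialLaw
open Classical Finset Summit.QuantumAdvantage.AdviceFreeQNC0
open Literature.Computability.MetaComplexity Literature.Computability.MetaComplexity.Smolensky
open Literature.Computability.Complexity (parityFn)

section Symmetric

variable {m : ℕ}

/-- the `q`-periodic symmetric class: `f(z) = g(|z| mod q)`. -/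
def symFn (q m : ℕ) (g : ℕ → Bool) (z : Fin m → Bool) : Bool := g (wt z % q)

/-- `χ_q = symFn q m [· = 0]`: the §16 extremal family is in the class. -/
theorem modqFn_eq_symFn (q m : ℕ) (_hq : 0 < q) : modqFn q m = symFn q m (fun s => decide (s = 0)) := by
  funext z; unfold modqFn symFn; simp only [Nat.dvd_iff_mod_eq_zero]

/-- shifted Lucas indicator: `C(w + q − 1 − s, q − 1) = [w ≡ s (mod q)]` in `𝔽_p` (`q = p^j`, `s < q`). -/
theorem choose_modq_indicator' (p : ℕ) [hp : Fact p.Prime] (j w s : ℕ) (hs : s < p ^ j) :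
    (((w + (p ^ j - 1 - s)).choose (p ^ j - 1) : ℕ) : ZMod p) = if w % p ^ j = s then 1 else 0 := by
  have h := (ZMod.natCast_eq_natCast_iff _ _ p).2 (choose_pow_sub_one_modEq p j (w + (p ^ j - 1 - s)))
  rw [h]
  set q := p ^ j with hq
  have hq1 : 1 ≤ q := Nat.one_le_pow _ _ hp.out.pos
  have hiff : (w + (q - 1 - s)) % q = q - 1 ↔ w % q = s := by
    have hw := Nat.div_add_mod w q
    have hwq : w % q < q := Nat.mod_lt _ (by omega)
    -- `w + (q-1-s) = q*(w/q) + (w%q + q - 1 - s)`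
    constructor
    · intro hmod
      have hd := Nat.div_add_mod (w + (q - 1 - s)) q
      rw [hmod] at hd
      -- `q * c + (q-1) = w + q - 1 - s`, i.e. `w - s ≡ 0`: compare with `w = q*(w/q) + w%q`
      by_contra hne
      rcases Nat.lt_or_gt_of_ne hne with hlt | hgt
      · -- `w % q < s`: then `w + (q-1-s) = q*(w/q) + (w%q + q-1-s)` with remainder `< q - 1`... contradiction
        have e1 : w + (q - 1 - s) = q * (w / q) + (w % q + (q - 1 - s)) := by omega
        have hr : (w % q + (q - 1 - s)) < q := by omega
        have := Nat.mul_add_mod_self_left q (w / q) (w % q + (q - 1 - s))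
        rw [← e1, Nat.mod_eq_of_lt hr] at this
        omega
      · have e1 : w + (q - 1 - s) = q * (w / q + 1) + (w % q - s - 1) := by
          rw [Nat.mul_succ]; omega
        have hr : (w % q - s - 1) < q := by omega
        have := Nat.mul_add_mod_self_left q (w / q + 1) (w % q - s - 1)
        rw [← e1, Nat.mod_eq_of_lt hr] at this
        omega
    · intro hws
      have e1 : w + (q - 1 - s) = q * (w / q) + (q - 1) := by omega
      rw [e1, Nat.mul_add_mod_self_left]
      exact Nat.mod_eq_of_lt (by omega)
  by_cases hd : w % q = s
  · rw [if_pos (hiff.2 hd), if_pos hd, Nat.cast_one]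
  · rw [if_neg (mt hiff.1 hd), if_neg hd, Nat.cast_zero]

/-- the residue indicators `[|z| ≡ s (mod p^j)]` have `𝔽_p`-degree `≤ p^j − 1`. -/
theorem ind_wt_mod_mem_lowDeg (p : ℕ) [hp : Fact p.Prime] (j m s : ℕ) (hs : s < p ^ j) :
    (fun z : Fin m → Bool => if wt z % p ^ j = s then (1 : ZMod p) else 0) ∈ lowDeg (ZMod p) m (p ^ j - 1) := by
  set q := p ^ j with hq
  set P : (Fin m → Bool) → ZMod p := ∑ k ∈ range (q - 1 + 1),
    (((q - 1 - s).choose (q - 1 - k) : ℕ) : ZMod p) • ∑ T ∈ (univ : Finset (Fin m)).powersetCard k, mono (ZMod p) T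
    with hPdef
  have hP : P ∈ lowDeg (ZMod p) m (q - 1) := by
    refine Submodule.sum_mem _ fun k hk => Submodule.smul_mem _ _ (Submodule.sum_mem _ fun T hT => ?_)
    refine mono_mem_lowDeg ?_
    rw [(mem_powersetCard.1 hT).2]
    have := mem_range.1 hk; omega
  have hPz : ∀ z, P z = if wt z % q = s then 1 else 0 := by
    intro z
    have hv : ((((wt z) + (q - 1 - s)).choose (q - 1) : ℕ) : ZMod p) =
        ∑ k ∈ range (q - 1 + 1), (((q - 1 - s).choose (q - 1 - k) : ℕ) : ZMod p) * (((wt z).choose k : ℕ) : ZMod p) := by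
      rw [Nat.add_choose_eq, Finset.Nat.sum_antidiagonal_eq_sum_range_succ
        (fun a b => (wt z).choose a * (q - 1 - s).choose b)]
      push_cast
      exact Finset.sum_congr rfl fun k _ => mul_comm _ _
    rw [hPdef, Finset.sum_apply]
    simp only [Pi.smul_apply, sum_mono_powersetCard_apply, smul_eq_mul]
    unfold wt at hv ⊢
    rw [← hv]
    have := choose_modq_indicator' p j ((univ.filter fun i => z i = true).card) s hs
    rw [← hq] at this
    rw [this]
  have : (fun z : Fin m → Bool => if wt z % q = s then (1 : ZMod p) else 0) = P := funext fun z => (hPz z).symm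
  rw [this]; exact hP

/-- **the class has degree `≤ q − 1`** (`q = p^j`): `symFn (p^j) m g` satisfies `HasDegF p · (p^j − 1)`. -/
theorem hasDegF_symFn (p : ℕ) [hp : Fact p.Prime] (j m : ℕ) (g : ℕ → Bool) :
    HasDegF p (symFn (p ^ j) m g) (p ^ j - 1) := by
  set q := p ^ j with hq
  have hq1 : 1 ≤ q := Nat.one_le_pow _ _ hp.out.pos
  unfold HasDegF
  have hrep : (fun z : Fin m → Bool => if symFn q m g z then (1 : ZMod p) else 0) =
      ∑ s ∈ (range q).filter (fun s => g s = true), (fun z : Fin m → Bool => if wt z % q = s then (1 : ZMod p) else 0) := by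
    funext z
    rw [Finset.sum_apply]
    unfold symFn
    have hzq : wt z % q < q := Nat.mod_lt _ (by omega)
    by_cases hg : g (wt z % q) = true
    · rw [if_pos hg]
      rw [Finset.sum_eq_single_of_mem (wt z % q) (mem_filter.2 ⟨mem_range.2 hzq, hg⟩)]
      · rw [if_pos rfl]
      · intro s hs hne; rw [if_neg (Ne.symm hne)]
    · rw [if_neg hg]
      symm
      refine Finset.sum_eq_zero fun s hs => ?_
      rw [mem_filter] at hs
      rw [if_neg]
      intro h; rw [h] at hg; exact hg hs.2
  rw [hrep]
  refine Submodule.sum_mem _ fun s hs => ?_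
  rw [hq]
  exact ind_wt_mod_mem_lowDeg p j m s (by rw [← hq]; exact mem_range.1 (mem_filter.1 hs).1)

/-- CRT for the weight (`q` odd): `|z| ≡ s (mod q) ∧ |z| ≡ c (mod 2)` is ONE residue class `mod 2q`. -/
theorem filter_wt_mod_eq (q : ℕ) (hqo : q % 2 = 1) (s c : ℕ) (hs : s < q) (hc : c < 2) :
    (univ.filter fun z : Fin m → Bool => wt z % q = s ∧ wt z % 2 = c) =
      univ.filter fun z : Fin m → Bool =>
        (((univ.filter fun i => z i = true).card : ℕ) : ZMod (2 * q)) =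
          (((if s % 2 = c then s else s + q : ℕ)) : ZMod (2 * q)) := by
  ext z
  simp only [mem_filter, mem_univ, true_and]
  rw [ZMod.natCast_eq_natCast_iff']
  unfold wt
  set w := (univ.filter fun i => z i = true).card with hw
  set r := (if s % 2 = c then s else s + q) with hr
  have hr2 : r < 2 * q := by rw [hr]; split_ifs <;> omega
  have hrq : r % q = s := by
    rw [hr]; split_ifs
    · exact Nat.mod_eq_of_lt hs
    · rw [Nat.add_mod_right]; exact Nat.mod_eq_of_lt hs
  have hrc : r % 2 = c := by rw [hr]; split_ifs <;> omega
  rw [Nat.mod_eq_of_lt hr2]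
  have ht2q : w % (2 * q) < 2 * q := Nat.mod_lt _ (by omega)
  have htq : w % (2 * q) % q = w % q := Nat.mod_mod_of_dvd w (Dvd.intro_left 2 rfl)
  have ht2 : w % (2 * q) % 2 = w % 2 := Nat.mod_mod_of_dvd w (Dvd.intro q rfl)
  set t := w % (2 * q) with htdef
  -- `t < 2q` with `t % q` known: `t = t % q` or `t = t % q + q`
  have ht_cases : t = t % q ∨ t = t % q + q := by
    have h1 := Nat.div_add_mod t q
    have h2 : t / q < 2 := (Nat.div_lt_iff_lt_mul (by omega)).2 (by omega)
    generalize hk : t / q = k at h1 h2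
    have hk2 : k = 0 ∨ k = 1 := by omega
    rcases hk2 with rfl | rfl
    · left; omega
    · right; omega
  constructor
  · rintro ⟨hws, hwc⟩
    rw [htq] at ht_cases; rw [hws] at ht_cases
    have htc : t % 2 = c := by rw [ht2]; exact hwc
    rw [hr]
    split_ifs with hsc
    · rcases ht_cases with h | h
      · exact h
      · exfalso; rw [h] at htc; omega
    · rcases ht_cases with h | h
      · exfalso; rw [h] at htc; exact hsc htc
      · exact h
  · intro htr
    refine ⟨?_, ?_⟩
    · rw [← htq, htr, hrq]
    · rw [← ht2, htr, hrc]

/-- the analytic input: `4q · (2cos(π/2q))^m ≤ 2^m` once `m ≥ 2q²(log₂ q + 3)` (via `cos(π/2q) ≤ 1 − 1/(2q²)`). -/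
theorem cos_pow_small (q m : ℕ) (hq : 1 ≤ q) (hm : 2 * q ^ 2 * (Nat.log 2 q + 3) ≤ m) :
    (4 * q : ℝ) * (2 * Real.cos (Real.pi / (2 * q))) ^ m ≤ 2 ^ m := by
  have hqR : (1 : ℝ) ≤ q := by exact_mod_cast hq
  have hπ := Real.pi_pos
  have hx : |Real.pi / (2 * q)| ≤ Real.pi := by
    rw [abs_of_nonneg (by positivity)]
    rw [div_le_iff₀ (by positivity)]; nlinarith
  have hcos_le : Real.cos (Real.pi / (2 * q)) ≤ 1 - 1 / (2 * (q : ℝ) ^ 2) := by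
    refine (Real.cos_le_one_sub_mul_cos_sq hx).trans (le_of_eq ?_)
    field_simp
  have hcos_nn : 0 ≤ Real.cos (Real.pi / (2 * q)) := by
    apply Real.cos_nonneg_of_neg_pi_div_two_le_of_le
    · linarith [show 0 ≤ Real.pi / (2 * q) by positivity]
    · rw [div_le_div_iff_of_pos_left hπ (by positivity) (by norm_num)]; linarith
  set y : ℝ := 1 / (2 * (q : ℝ) ^ 2) with hy
  have hy0 : 0 ≤ y := by positivity
  have hy1 : y ≤ 1 / 2 := by
    rw [hy, div_le_div_iff_of_pos_left (by norm_num) (by positivity) (by norm_num)]; nlinarith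
  have h1 : (2 * Real.cos (Real.pi / (2 * q))) ^ m ≤ (2 * (1 - y)) ^ m :=
    pow_le_pow_left₀ (by positivity) (by linarith) m
  have h2 : (1 - y) ^ m ≤ Real.exp (-y) ^ m := pow_le_pow_left₀ (by linarith) (Real.one_sub_le_exp_neg y) m
  have h3 : Real.exp (-y) ^ m = Real.exp (-(m * y)) := by rw [← Real.exp_nat_mul]; ring_nf
  -- `4q ≤ exp (m*y)` from `m*y ≥ log₂ q + 3 =: ℓ` and `exp ℓ ≥ 2^ℓ ≥ 8 · 2^{log₂ q} > 4q`
  set ℓ := Nat.log 2 q + 3 with hℓ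
  have hmy : (ℓ : ℝ) ≤ m * y := by
    rw [hy]
    have : (2 * q ^ 2 * ℓ : ℝ) ≤ m := by exact_mod_cast hm
    rw [show (m : ℝ) * (1 / (2 * (q : ℝ) ^ 2)) = m / (2 * (q : ℝ) ^ 2) by ring,
      le_div_iff₀ (by positivity)]
    linarith
  have hql : q < 2 ^ (Nat.log 2 q + 1) := Nat.lt_pow_succ_log_self (by norm_num) q
  have h4q : (4 * q : ℝ) ≤ 2 ^ ℓ := by
    have : 4 * q ≤ 2 ^ ℓ := by
      rw [hℓ, show Nat.log 2 q + 3 = (Nat.log 2 q + 1) + 2 by ring, pow_add]; omega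
    exact_mod_cast this
  have hexpℓ : (2 : ℝ) ^ ℓ ≤ Real.exp ℓ := by
    rw [show (ℓ : ℝ) = ℓ * 1 by ring, Real.exp_nat_mul]
    exact pow_le_pow_left₀ (by norm_num) (by have := Real.add_one_le_exp 1; linarith) ℓ
  have hexp : (4 * q : ℝ) ≤ Real.exp (m * y) :=
    h4q.trans (hexpℓ.trans (Real.exp_le_exp.2 hmy))
  have hpos : (0 : ℝ) < Real.exp (m * y) := Real.exp_pos _
  calc (4 * q : ℝ) * (2 * Real.cos (Real.pi / (2 * q))) ^ m
      ≤ (4 * q) * (2 * (1 - y)) ^ m := by gcongr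
    _ = 2 ^ m * ((4 * q) * (1 - y) ^ m) := by rw [mul_pow]; ring
    _ ≤ 2 ^ m * ((4 * q) * Real.exp (-(m * y))) := by rw [← h3]; gcongr
    _ ≤ 2 ^ m * 1 := by
        gcongr
        rw [Real.exp_neg, ← div_eq_mul_inv, div_le_one hpos]
        exact hexp
    _ = 2 ^ m := mul_one _

/-- residue classes of the weight `mod 2q` are within ratio `3` of each other once `m ≥ 2q²(log₂ q + 3)`. -/
theorem card_wt_mod_le_three_mul (q : ℕ) (hq : 1 ≤ q) (hm : 2 * q ^ 2 * (Nat.log 2 q + 3) ≤ m) (r r' : ℕ) :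
    (univ.filter fun z : Fin m → Bool =>
        (((univ.filter fun i => z i = true).card : ℕ) : ZMod (2 * q)) = (r : ZMod (2 * q))).card ≤
      3 * (univ.filter fun z : Fin m → Bool =>
        (((univ.filter fun i => z i = true).card : ℕ) : ZMod (2 * q)) = (r' : ZMod (2 * q))).card := by
  haveI : NeZero (2 * q) := ⟨by omega⟩
  have h2q : 2 ≤ 2 * q := by omega
  have hr := TwoModuli.abs_card_filter_card_eq_sub_le' (ι := Fin m) h2q (r : ZMod (2 * q))
  have hr' := TwoModuli.abs_card_filter_card_eq_sub_le' (ι := Fin m) h2q (r' : ZMod (2 * q))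
  rw [Fintype.card_fin] at hr hr'
  rw [abs_le] at hr hr'
  have hε := cos_pow_small q m hq hm
  push_cast at hr hr' hε
  have hqR : (0 : ℝ) < q := by exact_mod_cast hq
  set ε := (2 * Real.cos (Real.pi / (2 * (q : ℝ)))) ^ m with hεdef
  set E := ((univ.filter fun z : Fin m → Bool =>
        (((univ.filter fun i => z i = true).card : ℕ) : ZMod (2 * q)) = (r : ZMod (2 * q))).card : ℝ) with hE
  set E' := ((univ.filter fun z : Fin m → Bool =>
        (((univ.filter fun i => z i = true).card : ℕ) : ZMod (2 * q)) = (r' : ZMod (2 * q))).card : ℝ) with hE'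
  -- `E ≤ M + ε`, `E' ≥ M − ε`, `4qε ≤ 2^m = 2q·M`
  have hM : (2 : ℝ) ^ m / (2 * (q : ℝ)) * (2 * q) = 2 ^ m := by field_simp
  have key : E ≤ 3 * E' := by
    have h1 : E ≤ 2 ^ m / (2 * (q : ℝ)) + ε := by linarith [hr.2]
    have h2 : 2 ^ m / (2 * (q : ℝ)) - ε ≤ E' := by linarith [hr'.1]
    have h3 : 4 * ε ≤ 2 * (2 ^ m / (2 * (q : ℝ))) := by
      rw [show 2 * (2 ^ m / (2 * (q : ℝ))) = 2 ^ m / q by field_simp, le_div_iff₀ hqR]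
      linarith
    linarith
  rw [hE, hE'] at key
  exact_mod_cast key

/-- **Theorem (the extremiser class obeys the law at exponent 2).** For every ODD `q` and every `g`,
`symFn q m g` is `3`-balanced on `m ≥ 2q²(log₂ q + 3)` bits. -/
theorem relBal_three_symFn {q : ℕ} (hq : 1 ≤ q) (hqo : q % 2 = 1)
    (hm : 2 * q ^ 2 * (Nat.log 2 q + 3) ≤ m) (g : ℕ → Bool) : RelBal 3 (symFn q m g) := by
  -- both parts, fibred over the residue `s = |z| mod q`
  have hpart : ∀ c : ℕ, c < 2 → ∀ b : Bool, (b = true ↔ c = 1) →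
      (univ.filter fun z : Fin m → Bool => symFn q m g z = true ∧ parityFn m z = b).card =
        ∑ s ∈ (range q).filter (fun s => g s = true),
          (univ.filter fun z : Fin m → Bool =>
            (((univ.filter fun i => z i = true).card : ℕ) : ZMod (2 * q)) =
              (((if s % 2 = c then s else s + q : ℕ)) : ZMod (2 * q))).card := by
    intro c hc b hb
    rw [card_eq_sum_card_fiberwise (f := fun z : Fin m → Bool => wt z % q)
      (t := (range q).filter (fun s => g s = true)) ?_]
    · refine Finset.sum_congr rfl fun s hs => ?_
      rw [mem_filter, mem_range] at hs
      rw [← filter_wt_mod_eq q hqo s c hs.1 hc, Finset.filter_filter]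
      congr 1
      ext z
      simp only [mem_filter, mem_univ, true_and]
      unfold symFn
      rw [parityFn_eq_decide_wt]
      constructor
      · rintro ⟨⟨_, hpz⟩, hws⟩
        refine ⟨hws, ?_⟩
        cases b
        · have : ¬ (c = 1) := fun h => by simp [h] at hb
          have hwne : ¬ (wt z % 2 = 1) := by simpa using hpz
          omega
        · have : c = 1 := hb.1 rfl
          have hw1 : wt z % 2 = 1 := by simpa using hpz
          omega
      · rintro ⟨hws, hwc⟩
        refine ⟨⟨by rw [hws]; exact hs.2, ?_⟩, hws⟩
        cases b
        · have : ¬ (c = 1) := fun h => by simp [h] at hb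
          simp; omega
        · have : c = 1 := hb.1 rfl
          simp; omega
    · intro z hz
      rw [Finset.mem_coe, mem_filter] at hz
      rw [Finset.mem_coe, mem_filter, mem_range]
      exact ⟨Nat.mod_lt _ (by omega), by unfold symFn at hz; exact hz.2.1⟩
  have hodd := hpart 1 (by norm_num) true (by simp)
  have heven := hpart 0 (by norm_num) false (by simp)
  unfold RelBal oddPart evenPart
  rw [hodd, heven, Finset.mul_sum, Finset.mul_sum]
  exact ⟨Finset.sum_le_sum fun s _ => card_wt_mod_le_three_mul q hq hm _ _,
    Finset.sum_le_sum fun s _ => card_wt_mod_le_three_mul q hq hm _ _⟩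

/-- **Corollary (no symmetric counterexample).** In the window of the residual no `q`-periodic symmetric
function (`q` odd, `2q²(log₂ q + 3) ≤ m`) is unbalanced — in particular none of the extremisers `χ_q`, `e_{p−1}`,
digit readers refutes `RelSmolPolyOdd`; a minimal counterexample is ASYMMETRIC. -/
theorem not_symmetric_of_not_relBal {q : ℕ} (hq : 1 ≤ q) (hqo : q % 2 = 1)
    (hm : 2 * q ^ 2 * (Nat.log 2 q + 3) ≤ m) {f : (Fin m → Bool) → Bool} (hf : ¬ RelBal 3 f) (g : ℕ → Bool) :
    f ≠ symFn q m g := by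
  rintro rfl; exact hf (relBal_three_symFn hq hqo hm g)

end Symmetric

/-- **NORMAL FORM, sharpened by §17 (law level).**  If the dialed law fails then, at some prime `p ≥ 5`, for every
polynomial scale there is an unbalanced mixed level set in the window `A(d+1)^B ≤ m < (d+1)²4^{d+1}` which is NOT
`q`-periodic symmetric for any odd `q` with `2q²(log₂ q + 3) ≤ m`. -/
theorem normalForm_asymmetric_law (h : ¬ ∀ (p : ℕ) [Fact p.Prime], 5 ≤ p → ∃ B : ℕ, RelSmolLaw p 3 B) :
    ∃ (p : ℕ) (_ : Fact p.Prime), 5 ≤ p ∧ ∀ B A : ℕ, ∃ (m d : ℕ) (f : (Fin m → Bool) → Bool),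
      A * (d + 1) ^ B ≤ m ∧ m < (d + 1) ^ 2 * 4 ^ (d + 1) ∧ HasDegF p f d ∧ ¬ RelBal 3 f ∧
      (oddPart f).Nonempty ∧ (evenPart f).Nonempty ∧
      ∀ (q : ℕ) (g : ℕ → Bool), q % 2 = 1 → 2 * q ^ 2 * (Nat.log 2 q + 3) ≤ m → f ≠ symFn q m g := by
  obtain ⟨p, hP, hp, hall⟩ := normalForm_of_not_relSmolPoly h
  refine ⟨p, hP, hp, fun B A => ?_⟩
  obtain ⟨m, d, f, h1, h2, h3, h4, h5, h6⟩ := hall B A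
  exact ⟨m, d, f, h1, h2, h3, h4, h5, h6, fun q g hqo hm => not_symmetric_of_not_relBal (by omega) hqo hm h4 g⟩


/-! ### §18 INTRINSIC ASYMMETRY: a weight-determined function of degree `d < p^j` IS `p^j`-periodic

Closing the gap between «not of the form `g(|z| mod q)`» (§17) and «not symmetric»: if `f` depends only on `|z|`
and has `𝔽_p`-degree `≤ d < q = p^j`, then `f = symFn q m g` (`symFn_of_wtDetermined`).  Mechanism (no appeal to
uniqueness of multilinear coefficients, which fails to be usable by averaging in characteristic `p ≤ m`): restrict
`f` to a `q`-dimensional sub-cube above `w` fixed ones; the alternating sum `Σ_y (−1)^{|y|} G(y)` of a function of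
degree `< q` on `{0,1}^q` vanishes (`altSum_eq_zero`), and grouping by weight it equals
`Σ_k (−1)^k C(q,k) φ(w+k) = φ(w) − φ(w+q)` in `𝔽_p` since `p ∣ C(p^j, k)` for `0 < k < p^j`. -/


end Summit.QuantumAdvantage.QuantumAdvantage.Theorems.PurityDialLaw
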